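import Literature.AnabelianGeometry.SemiGraphs.ArithmeticCoveringsLem55Sub

/-!
# [SemiAnbd] Lemma 5.5 AS TYPED — the closing token of the cone node `SemiAnbd:Lem5.5`: what the typed predicate says, hypothesis-free

Mochizuki, *Semi-graphs of anabelioids*, Publ. RIMS **42** (2006); kurims manuscript
`paper:url-f33ace170ff4`, Lemma 5.5 p.66 (statement l.−12 – l.−8; proof p.66 l.−7 – p.67 l.12):
"Let `X` be a proper hyperbolic curve over a finite field `k`. Write `Π_X` for the étale fundamental group
of `X`; `Π_X ↠ G_k` for the natural augmentation … Then a `k`-valued point `x ∈ X(k)` is determined by the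
outer homomorphism `σ_x : G_k → Π_X` that it induces." [cite: MochizukiSemiAnbd2006, Lem 5.5, p. 66]

PROOF-ONLY companion (cell abc-iut, layer L3, cone row `SemiAnbd:Lem5.5`, seat abc-iut-L3-d3 gen 7; no
definition, no instance, no notation) of the FROZEN statement file `ArithmeticCoverings.lean` (p404854), whose
node decl is the PARAMETRISED PREDICATE on abstract data
`DecompositionGroupsDetermineStatement aug σ` (`aug : Π_X →* G_k`, `σ : X(k) → (G_k →* Π_X)`; the cell's
fact-list row F-1367, class «predicate / vocabulary — nothing to assume»).  A predicate is not a claim: it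
has no `_holds`.  What the kernel CAN certify about the node as typed, with NO hypothesis and NO named fact,
is collected here so that the node's books close on theorems rather than on prose:

* `decompositionGroupsDetermineStatement_iff` — the statement displayed (definitional unfolding).
* `decompositionGroupsDetermineStatement_iff_injective_outerSection` — AS TYPED the node says EXACTLY:
  under its sections premise, the map `x ↦ [σ_x]`, `[σ_x] :=` the `Inn(Π_X)`-orbit of `σ_x` in
  `Hom(G_k, Π_X)` — i.e. the OUTER homomorphism of the printed statement — is injective on `X(k)`
  (Mathlib `MulAut.conj`; the orbit as `Set.range`).
* `decompositionGroupsDetermineStatement_iff_kummerInjective` — `Π_X`-conjugate sections are already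
  `Δ_X`-conjugate, `Δ_X := Ker(Π_X ↠ G_k)` (sub-DAG row L03, `Lem55.isKerConj_of_conj`, p414021), so AT THE
  SAME DATA the node is EQUIVALENT to «sections ⇒ `Lem55.KummerInjectiveStatement aug σ`» (injectivity of
  the section-class map `x ↦ (Δ_X-conjugacy class of σ_x)`, the non-abelian `H¹(G_k, Δ_X)` reading): the
  sub-DAG's row-L06 implication `Lem55.decompositionGroupsDetermine_of_kummerInjective` is an equivalence.
  (At Jacobian data with commutative kernel the `H¹`-LITERAL form of the same equivalence is p414277,
  `Lem55.decompositionGroupsDetermine_of_kummerClass_injective` / `kummerClass_injective_of_…`.)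
* `decompositionGroupsDetermineStatement_iff_injective_of_comm` — at data with commutative `Π_X` (e.g. the
  `ℤ_p` toy of record, `Lem55Toy.decompositionGroupsDetermine_toy`, p462644) the node is plain injectivity
  of `x ↦ σ_x`.
* `not_forall_decompositionGroupsDetermineStatement` — the BARE universal closure of the predicate over
  abstract data is FALSE (trivial groups, two points sharing the identity section; the read-only probe of
  abc-iut-w4-d079 gen 8, 2026-08-27T02:25Z, made a landed theorem): the content of Lemma 5.5 lives in the
  arithmetic data (proper hyperbolic `X`, finite `k`, étale `π₁` — TODO-merge abc-iut-L4-t1, not in the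
  tree), which is why the node is consumed BY NAME at data and never closed as a `∀`.

Provenance kept BY NAME, not re-proved: the PRINTED PROOF is the landed sub-DAG
(`plan/L3/SUBDAG-SemiAnbd-Lem55.md`; `ArithmeticCoveringsLem55Sub.lean` p414021 —
`Lem55.lemma55_of_steps : AbelJacobi (L02) → sections → KummerInjective (L05) → node`; `…Lem55H1.lean`
p414277), which REDUCES the node to the two CITED inputs of print p.67 l.1–10 (Abel–Jacobi on `k`-points;
"well-known general nonsense [[Naka] Claim (2.2); [NTs] Lemma (4.14); [Mzk2]] `H¹(k, T) ⥲ J(k)`") — cited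
arithmetic geometry, hypotheses by name under the cell's FACT policy; consumer of the node by name:
`ArithEstrangementOfLem55.lean` p460908 (Ex 5.6 «immediately from Lemma 5.5»).  Characterised-as-typed ≠
proved-in-print; typed ≠ proved; nothing here bears on [IUTchIII] Cor 3.12; no side taken.
-/

namespace Literature.AnabelianGeometry.SemiGraphs

namespace Lem55

variable {PX Gk : Type*} [Group PX] [Group Gk] (aug : PX →* Gk)
variable {Pts : Type*} (σ : Pts → (Gk →* PX))

/-! ### The statement displayed -/

/-- **[SemiAnbd] Lem 5.5 as typed, unfolded.** `DecompositionGroupsDetermineStatement aug σ` reads: IF every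
`σ_x` is a section of `aug : Π_X ↠ G_k`, THEN two points whose sections are `Π_X`-conjugate are equal.
Definitional (`Iff.rfl`); recorded so that the books quote the kernel, not the docstring.
[cite: MochizukiSemiAnbd2006, Lem 5.5, p. 66] -/
theorem decompositionGroupsDetermineStatement_iff :
    DecompositionGroupsDetermineStatement aug σ ↔
      ((∀ x, aug.comp (σ x) = MonoidHom.id Gk) →
        ∀ x y : Pts, (∃ g : PX, ∀ t : Gk, σ y t = g * σ x t * g⁻¹) → x = y) :=
  Iff.rfl

/-! ### The node = injectivity of the outer-section map `x ↦ [σ_x]` -/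

/-- Two homomorphisms `s, s' : G_k → Π_X` have the same `Inn(Π_X)`-orbit in `Hom(G_k, Π_X)` (define the same
OUTER homomorphism) iff `s'` is a `Π_X`-conjugate of `s`. Group theory, PROVED.
[cite: MochizukiSemiAnbd2006, Lem 5.5, p. 66] -/
theorem range_conj_comp_eq_iff (s s' : Gk →* PX) :
    (Set.range fun g : PX => (MulAut.conj g).toMonoidHom.comp s) =
        Set.range (fun g : PX => (MulAut.conj g).toMonoidHom.comp s') ↔
      ∃ g : PX, ∀ t : Gk, s' t = g * s t * g⁻¹ := by
  constructor
  · intro h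
    have hs' : s' ∈ Set.range fun g : PX => (MulAut.conj g).toMonoidHom.comp s := by
      rw [h]
      exact ⟨1, by ext t; simp⟩
    obtain ⟨g, hg⟩ := hs'
    refine ⟨g, fun t => ?_⟩
    have := DFunLike.congr_fun hg t
    simpa only [MonoidHom.coe_comp, Function.comp_apply, MulEquiv.coe_toMonoidHom,
      MulAut.conj_apply] using this.symm
  · rintro ⟨g, hg⟩
    ext u
    constructor
    · rintro ⟨k, rfl⟩
      refine ⟨k * g⁻¹, ?_⟩
      ext t
      simp only [MonoidHom.coe_comp, Function.comp_apply, MulEquiv.coe_toMonoidHom,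
        MulAut.conj_apply, hg t]
      group
    · rintro ⟨k, rfl⟩
      refine ⟨k * g, ?_⟩
      ext t
      simp only [MonoidHom.coe_comp, Function.comp_apply, MulEquiv.coe_toMonoidHom,
        MulAut.conj_apply, hg t]
      group

/-- **[SemiAnbd] Lem 5.5 as typed = injectivity of the outer-section map.** For every augmentation
`aug : Π_X → G_k` and every family of homomorphisms `σ : X(k) → Hom(G_k, Π_X)`:
`DecompositionGroupsDetermineStatement aug σ` holds iff, granted that the `σ_x` are sections, the map
`x ↦ [σ_x]` to OUTER homomorphisms (`[σ_x] :=` the `Inn(Π_X)`-orbit `{Inn(g) ∘ σ_x | g ∈ Π_X}`) is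
injective — print: "`x ∈ X(k)` is determined by the outer homomorphism `σ_x : G_k → Π_X` that it induces".
Hypothesis-free characterisation of the typed node; PROVED (group theory).  It does not assert the node at
any data. [cite: MochizukiSemiAnbd2006, Lem 5.5, p. 66] -/
theorem decompositionGroupsDetermineStatement_iff_injective_outerSection :
    DecompositionGroupsDetermineStatement aug σ ↔
      ((∀ x, aug.comp (σ x) = MonoidHom.id Gk) →
        Function.Injective fun x : Pts =>
          Set.range fun g : PX => (MulAut.conj g).toMonoidHom.comp (σ x)) := by
  constructor
  · intro h hsec x y hxy
    exact h hsec x y ((range_conj_comp_eq_iff (σ x) (σ y)).1 hxy)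
  · rintro h hsec x y hxy
    exact h hsec ((range_conj_comp_eq_iff (σ x) (σ y)).2 hxy)

/-! ### The node = injectivity of the section-class map (the sub-DAG's `KummerInjectiveStatement` at the same data) -/

/-- **[SemiAnbd] Lem 5.5 as typed ⟺ Kummer-injectivity at the same data.** Sections that are conjugate under
an arbitrary `g ∈ Π_X` are already conjugate under `Δ_X := Ker(aug)` (`Lem55.isKerConj_of_conj`, sub-DAG
row L03: the image of `g` in `G_k` centralises `G_k`), so the node is EQUIVALENT to: granted that the `σ_x`
are sections, `x ↦ (Δ_X-conjugacy class of σ_x)` is injective — `Lem55.KummerInjectiveStatement aug σ`, the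
load-bearing half of the cited fact of print p.67 l.7–10 READ AT THE DATA `(Π_X ↠ G_k, X(k))` itself.  Hence
the sub-DAG's row-L06 implication `decompositionGroupsDetermine_of_kummerInjective` loses nothing.  PROVED
(group theory); asserts the node at no data. [cite: MochizukiSemiAnbd2006, Lem 5.5 proof, p. 67] -/
theorem decompositionGroupsDetermineStatement_iff_kummerInjective :
    DecompositionGroupsDetermineStatement aug σ ↔
      ((∀ x, aug.comp (σ x) = MonoidHom.id Gk) → KummerInjectiveStatement aug σ) := by
  constructor
  · rintro h hsec a b ⟨τ, -, hτ⟩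
    exact h hsec a b ⟨τ, hτ⟩
  · rintro h hsec x y ⟨g, hg⟩
    exact h hsec x y (isKerConj_of_conj aug (σ x) (σ y) (hsec x) (hsec y) g hg)

/-- At data with COMMUTATIVE `Π_X` (no inner automorphisms; e.g. the `ℤ_p`-linear toy of record
`Lem55Toy.decompositionGroupsDetermine_toy`, p462644) the node as typed is plain injectivity of `x ↦ σ_x`
(granted sections). PROVED. [cite: MochizukiSemiAnbd2006, Lem 5.5, p. 66] -/
theorem decompositionGroupsDetermineStatement_iff_injective_of_comm {PX Gk : Type*} [CommGroup PX]
    [Group Gk] (aug : PX →* Gk) {Pts : Type*} (σ : Pts → (Gk →* PX)) :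
    DecompositionGroupsDetermineStatement aug σ ↔
      ((∀ x, aug.comp (σ x) = MonoidHom.id Gk) → Function.Injective σ) := by
  constructor
  · intro h hsec x y hxy
    exact h hsec x y ⟨1, fun t => by simp [hxy]⟩
  · rintro h hsec x y ⟨g, hg⟩
    refine (h hsec ?_).symm
    ext t
    rw [hg t, mul_inv_cancel_comm]

/-! ### The bare universal closure is false: the content lives in the data -/

/-- **The typed predicate is not a theorem schema.** The universal closure of
`DecompositionGroupsDetermineStatement` over ABSTRACT data is false: for the trivial augmentation
`1 → 1` and two points `true ≠ false` both carrying the identity section, the premise holds and the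
conclusion fails.  So the node can only be consumed BY NAME at data (as the cell does: p460908), and
[SemiAnbd] Lemma 5.5 is a statement about SPECIFIC data — the étale `Π_X ↠ G_k` of a proper hyperbolic
curve over a finite field with the sections of its `k`-points — whose printed proof the sub-DAG (p414021,
p414277) reduces to the cited inputs [Naka] Claim (2.2) / [NTs] Lemma (4.14) / [Mzk2].  PROVED (the
2026-08-27 read-only probe of abc-iut-w4-d079 gen 8, landed). [cite: MochizukiSemiAnbd2006, Lem 5.5, p. 66] -/
theorem not_forall_decompositionGroupsDetermineStatement :
    ¬ ∀ (PX Gk : Type) [Group PX] [Group Gk] (aug : PX →* Gk) (Pts : Type) (σ : Pts → (Gk →* PX)),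
        DecompositionGroupsDetermineStatement aug σ := by
  intro h
  have key := h Unit Unit (MonoidHom.id Unit) Bool (fun _ => MonoidHom.id Unit) (fun _ => rfl)
    true false ⟨1, fun _ => by simp⟩
  exact Bool.noConfusion key

end Lem55

end Literature.AnabelianGeometry.SemiGraphs
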